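/-
Copyright: cell pub-balaban-gaps (YM BLITZ Y1, track G1), seat g1-p2 GEN 10 (unit `pub-balaban-gaps-g1-p2`).  Row (D4) NODE O,
JUNCTION J-3 (multi-level): GEN 9's ADJOINT-representation Green-function ENDs (89) RE-RUN on 100's no-gauge END, so that every term
carries the level-weighted COVARIANT derivative letters IN THE ADJOINT REPRESENTATION — `∇_{R(U),μ}λ(x) = η⁻¹(U(x)λ(x + e_μ)U(x)⁻¹ − λ(x))`
as the fibred operator `covDf` at the bond field `R(U) = conjOp U U⁻` — with relative letters `covBU δ₁ L (L·α₀(2 + α₀))`: print's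
`(L^jη)^{−1}|∇_U G|` of Thm 3.1 (3.42) for the vector-potential (adjoint) fibre.  HONEST FRAMING: compositions of typed hypothesis shapes;
nothing of Bałaban's asserted; the restriction to `𝔤 ⊂ gl(N, ℂ)` NOT made; (D4) instance 0∕1; NOT BetaPertH, NOT continuum, NOT Clay.
-/
import Summits.QuantumFields.BalabanUV.Gaps.D4WalkBlockCovariantGaugeDerivMultiLevel
import Summits.QuantumFields.BalabanUV.Gaps.D4WalkBlockAdjointWindow
import Summits.QuantumFields.BalabanUV.Gaps.D4WalkBlockExpHolo

/-!
# `Gaps.D4WalkBlockCovariantAdjointCovMultiLevel` — the adjoint-representation Green-function expansion with covariant derivative letters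
# (cell pub-balaban-gaps, seat g1-p2 gen 10)

HONEST DEPENDENCY (cell pub-balaban, verbatim): continuum YM on T⁴ ⇐ BetaPertH ∧ nine spine estimates (0/9 proved);
BetaPertH ⇐ (D1) ∧ (D4) ∧ CAP+tail.

* **`blockWalkExpansion_covariantGreenAdCov_multiLevelTorus`** — 89's first END (two-sided (3.37) windows of `U` ⟹ BWE of the Green
  function of the covariant multi-level operator in the adjoint representation) with the letter conjunct in the COVARIANT family
  `covDopU` at `(R(U), R(U)⁻)`, relative letters `covBU δ₁ L (L·α₀(2 + α₀))` (100's `blockWalkExpansion_covariantGreenCov_multiLevelTorus`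
  fed exactly as 89 feeds 84).
* **`blockWalkExpansion_covariantGreenAdExpCov_multiLevelTorus`** — the same for `U = e^{X}`, two-sided windows + holomorphy on `X`.
WHAT IT IS NOT.  `𝔤`-valuedness; `U` from (3.35)–(3.36); (D4) instance 0∕1; words of row (D4) UNCHANGED.

References: T. Bałaban, Comm. Math. Phys. **99** (1985) 389–434 [B9], p. 390, (3.19) p. 393, (3.37) p. 396, Thm 3.1 (3.42) p. 397,
(3.50)–(3.54) pp. 400–401, Cor. 3.5 p. 407; Comm. Math. Phys. **96** (1984) [4], (2.13)–(2.14) p. 225; Comm. Math. Phys. **116** (1988) [II], (1.11) p. 5.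
-/

noncomputable section

namespace Summit.QuantumFields.BalabanUV.Gaps.D4WalkBlockCovariantAdjointCovMultiLevel

open Metric NormedSpace
open scoped Matrix
open Literature.MathematicalPhysics.QuantumFieldTheory.Balaban1983to89
open Literature.MathematicalPhysics.QuantumFieldTheory.Balaban1983to89.B4Reflection242 (boxDom blk)
open Literature.MathematicalPhysics.QuantumFieldTheory.Balaban1983to89.B9SectDWalk (DomBy)
open Literature.MathematicalPhysics.QuantumFieldTheory.Balaban1983to89.B9Thm34Ext (toB6)
open Literature.MathematicalPhysics.QuantumFieldTheory.Balaban1983to89.B9Thm37GlueTorus (torusGeom tdist1)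
open Literature.MathematicalPhysics.QuantumFieldTheory.Balaban1983to89.TreeLengthTorus (TPt)
open Literature.MathematicalPhysics.QuantumFieldTheory.Balaban1983to89.B5TorusCover (UT)
open Literature.MathematicalPhysics.QuantumFieldTheory.Balaban1983to89.B11SectG (RowSum)
open Literature.MathematicalPhysics.QuantumFieldTheory.Balaban1983to89.B6MultiLevelBoxOperator (N0)
open Literature.MathematicalPhysics.QuantumFieldTheory.Balaban1983to89.B6MultiLevelTorusOperator (TDomains gmlT tshift unitVec)
open Literature.MathematicalPhysics.QuantumFieldTheory.Balaban1983to89.B6Ineq243TwoLevelBox (aNext)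
open Summit.QuantumFields.BalabanUV.Gaps.D4WalkBlock (blockNorm BlockWalkExpansion)
open Summit.QuantumFields.BalabanUV.Gaps.D4WalkBlockMultiLevelGeometry (cubeML)
open Summit.QuantumFields.BalabanUV.Gaps.D4WalkBlockTransportAlgebra (conjOp rowSumNorm colSumNorm)
open Summit.QuantumFields.BalabanUV.Gaps.D4WalkBlockShiftStep (covLap)
open Summit.QuantumFields.BalabanUV.Gaps.D4WalkBlockShiftWeighted (covDopW covBW covAlphaW)
open Summit.QuantumFields.BalabanUV.Gaps.D4WalkBlockWeightedLettersMultiLevel (levW)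
open Summit.QuantumFields.BalabanUV.Gaps.D4WalkBlockCovariantAveragingMultiLevel (covAvgOp)
open Summit.QuantumFields.BalabanUV.Gaps.D4WalkBlockCovariantContourMultiLevel (contourT contourTi)
open Summit.QuantumFields.BalabanUV.Gaps.D4WalkBlockCovariantDerivative (covDopU)
open Summit.QuantumFields.BalabanUV.Gaps.D4WalkBlockCovariantDerivativeLetters (covBU)
open Summit.QuantumFields.BalabanUV.Gaps.D4WalkBlockCovariantGaugeDerivMultiLevel (blockWalkExpansion_covariantGreenCov_multiLevelTorus)
open Summit.QuantumFields.BalabanUV.Gaps.D4WalkBlockAdjointWindow (conjOp_holo conjOp_mul_conjOp_eq_one rowMass_adjBond_le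
  rowMass_adjDeriv_le colSumNorm_inv_sub_inv_le)
open Summit.QuantumFields.BalabanUV.Gaps.D4WalkBlockExpWindow (rowSumNorm_neg colSumNorm_neg rowSumNorm_exp_sub_one_le
  colSumNorm_exp_sub_one_le rowSumNorm_exp_sub_exp_le colSumNorm_exp_sub_exp_le exp_sub_one_le_eps)
open Summit.QuantumFields.BalabanUV.Gaps.D4WalkBlockExpHolo (differentiableOn_exp_entry_family differentiableOn_exp_neg_entry_family)

variable {d : ℕ}

section Green

variable {dd N' : ℕ} {E : Type*} [NormedAddCommGroup E] [NormedSpace ℂ E]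

/-- **[B9] COR. 3.5 FOR THE GREEN FUNCTION OF THE COVARIANT MULTI-LEVEL OPERATOR IN THE ADJOINT REPRESENTATION, ON THE GENUINE
NESTED FAMILY.**  84's fibre-generic theorem at the pair fibre `Fin N × Fin N` with the bond field `R(U) = conjOp U U⁻` and inverse
`conjOp U⁻ U`; hypotheses: entries of `U`, `U⁻` holomorphic on the ball, `UU⁻ = 1`, TWO-SIDED (row and column) (3.37) windows of
`U − 1`, `U⁻ − 1` (bond, `α₀L^{−lev y}`) and of `U(x) − U(x − e_μ)` (derivative, `α₁L^{−2lev x}`); margin: 84's with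
`α₀ ↦ α₀(2 + α₀)`, `α₁ ↦ (1 + α₀)(1 + (1 + α₀)²)α₁`.
[cite: Balaban1985BackgroundPropagators, Cor. 3.5 p.407, p.390, (3.23) p.394, (3.37) p.396, (3.50)–(3.54) pp.400–401, (3.62)–(3.64) p.402; Balaban1984PropagatorsII, (2.13)–(2.14) p.225; Balaban1988RG2Cluster, (1.11) p.5] -/
theorem blockWalkExpansion_covariantGreenAdCov_multiLevelTorus (d ℓ : ℕ) (hℓ : 1 ≤ ℓ) (aminus aplus a2minus a2plus : ℝ)
    (ha : 0 < aminus) (ha2 : 0 < a2minus) :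
    ∃ δ₁ C M₀ : ℝ, ∃ N₀ : ℕ, 0 < δ₁ ∧ 0 < C ∧ 0 < M₀ ∧ 0 < N₀ ∧
      ∀ (k Mh R : ℕ), 3 ≤ Mh → M₀ ≤ ((ℓ : ℝ) + 1) * Mh → 2 * (ℓ + 1) ≤ R → N₀ + 1 ≤ R * ((ℓ + 1) * Mh) →
      ∀ (P : Fin (d + 1) → ℕ) (hP : ∀ μ, 1 ≤ P μ) (hP4 : ∀ μ, 4 ≤ P μ) (D : TDomains d ℓ Mh k P R) (a c : ℕ → ℝ),
        (∀ i, 1 ≤ i → aminus ≤ a i ∧ a i ≤ aplus) → (∀ i, 1 ≤ i → a2minus ≤ c i ∧ c i ≤ a2plus) →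
        (∀ i, 1 ≤ i → a (i + 1) = aNext ℓ (a i) (c i)) →
      ∀ (Kc : Fin (d + 1) → ℕ) [∀ i, NeZero (Kc i)], (∀ i, N0 ℓ Mh k P i = (ℓ + 1) ^ k * Kc i) →
      ∀ (N : ℕ) (c₀ : B13.Consts) (Xs : Finset (UT Kc)) (Rb : ℝ)
        (U Ui : Fin (d + 1) → E → ↥(boxDom (N0 ℓ Mh k P)) → Matrix (Fin N) (Fin N) ℂ)
        (Γ : ↥(boxDom (N0 ℓ Mh k P)) → List (↥(boxDom (N0 ℓ Mh k P)) × Fin (d + 1))) (α₀ α₁ ε μ cμ : ℝ),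
      (∀ ν y a' b, DifferentiableOn ℂ (fun u => U ν u y a' b) (ball (0 : E) Rb)) →
      (∀ ν y a' b, DifferentiableOn ℂ (fun u => Ui ν u y a' b) (ball (0 : E) Rb)) →
      (∀ ν u y, U ν u y * Ui ν u y = 1) → 0 ≤ α₀ → 0 ≤ α₁ →
      (∀ ν, ∀ u ∈ ball (0 : E) Rb, ∀ y a', rowSumNorm (U ν u y - 1) a' ≤ α₀ * ((((ℓ : ℝ) + 1) ^ D.lev y.1))⁻¹) →
      (∀ ν, ∀ u ∈ ball (0 : E) Rb, ∀ y b, colSumNorm (U ν u y - 1) b ≤ α₀ * ((((ℓ : ℝ) + 1) ^ D.lev y.1))⁻¹) →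
      (∀ ν, ∀ u ∈ ball (0 : E) Rb, ∀ y a', rowSumNorm (Ui ν u y - 1) a' ≤ α₀ * ((((ℓ : ℝ) + 1) ^ D.lev y.1))⁻¹) →
      (∀ ν, ∀ u ∈ ball (0 : E) Rb, ∀ y b, colSumNorm (Ui ν u y - 1) b ≤ α₀ * ((((ℓ : ℝ) + 1) ^ D.lev y.1))⁻¹) →
      (∀ ν, ∀ u ∈ ball (0 : E) Rb, ∀ x a', rowSumNorm (U ν u x - U ν u ((tshift (N0 ℓ Mh k P) (unitVec ν)).symm x)) a' ≤
        α₁ * ((((ℓ : ℝ) + 1) ^ D.lev x.1))⁻¹ ^ 2) →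
      (∀ ν, ∀ u ∈ ball (0 : E) Rb, ∀ x b, colSumNorm (U ν u x - U ν u ((tshift (N0 ℓ Mh k P) (unitVec ν)).symm x)) b ≤
        α₁ * ((((ℓ : ℝ) + 1) ^ D.lev x.1))⁻¹ ^ 2) →
      (∀ x, (Γ x).length ≤ (d + 1) * (ℓ + 1) ^ D.lev x.1) →
      (∀ x, ∀ b ∈ Γ x, blk ((ℓ + 1) ^ D.lev x.1) b.1.1 = blk ((ℓ + 1) ^ D.lev x.1) x.1) →
      0 ≤ μ → 2 * μ ≤ ε → 2 * μ ≤ δ₁ - ε - μ → 0 ≤ cμ →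
      RowSum (toB6 (torusGeom Kc 0 0 0) 0 True) μ cμ →
      cμ * (cμ * 1 * (1 * ((0 + ∑ j : Unit ⊕ (Fin (d + 1) ⊕ Fin (d + 1)),
        covAlphaW (((ℓ : ℝ) + 1) * (α₀ * (2 + α₀))) (((d : ℝ) + 1) * (((1 + α₀) * (1 + (1 + α₀) ^ 2) * α₁) + (((ℓ : ℝ) + 1) * (α₀ * (2 + α₀))) ^ 2) +
          aplus * (Real.exp (2 * ((d : ℝ) + 1) * (α₀ * (2 + α₀))) - 1)) j * covBW δ₁ ((ℓ : ℝ) + 1) j) * C)) * cμ) * cμ < 1 →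
      ∃ (W : Type) (T : W → (TPt dd N' → ℂ) → E → Matrix (↥(boxDom (N0 ℓ Mh k P)) × (Fin N × Fin N)) (↥(boxDom (N0 ℓ Mh k P)) × (Fin N × Fin N)) ℂ)
        (SX' : Set W) (A' : W → ℝ) (D' : W → UT Kc → UT Kc → ℝ),
        BlockWalkExpansion c₀ (fun q : ↥(boxDom (N0 ℓ Mh k P)) × (Fin N × Fin N) => cubeML ℓ k Kc q.1.1)
          (fun q : ↥(boxDom (N0 ℓ Mh k P)) × (Fin N × Fin N) => cubeML ℓ k Kc q.1.1)
          (fun (_ : TPt dd N' → ℂ) u =>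
            (covLap ↥(boxDom (N0 ℓ Mh k P)) (Fin N × Fin N) (fun ν => tshift (N0 ℓ Mh k P) (unitVec ν)) ((((ℓ : ℝ) + 1) ^ k)⁻¹)
                (fun ν u x => conjOp (U ν u x) (Ui ν u x) - 1)
                (fun ν u x => conjOp (Ui ν u ((tshift (N0 ℓ Mh k P) (unitVec ν)).symm x))
                  (U ν u ((tshift (N0 ℓ Mh k P) (unitVec ν)).symm x)) - 1) u +
              (((ℓ : ℂ) + 1) ^ (2 * k) : ℂ) • covAvgOp D a (contourT Γ fun u b => conjOp (U b.2 u b.1) (Ui b.2 u b.1))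
                (contourTi Γ fun u b => conjOp (Ui b.2 u b.1) (U b.2 u b.1)) u)⁻¹)
          Xs Rb (ε - 2 * μ) (δ₁ - ε - μ - 2 * μ)
          (cμ * C * (1 * (1 - cμ * (cμ * 1 * (1 * ((0 + ∑ j : Unit ⊕ (Fin (d + 1) ⊕ Fin (d + 1)),
            covAlphaW (((ℓ : ℝ) + 1) * (α₀ * (2 + α₀))) (((d : ℝ) + 1) * (((1 + α₀) * (1 + (1 + α₀) ^ 2) * α₁) + (((ℓ : ℝ) + 1) * (α₀ * (2 + α₀))) ^ 2) +
              aplus * (Real.exp (2 * ((d : ℝ) + 1) * (α₀ * (2 + α₀))) - 1)) j * covBW δ₁ ((ℓ : ℝ) + 1) j) * C)) * cμ) * cμ)⁻¹) * cμ)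
          T SX' A' D' (δ₁ - 2 * μ) ∧
        (∀ (j : Unit ⊕ (Fin (d + 1) ⊕ Fin (d + 1))) ω (σ : TPt dd N' → ℂ), (∀ i, ‖σ i‖ ≤ Real.exp c₀.κ₁) →
          ∀ u ∈ ball (0 : E) Rb, ∀ Y Y',
          blockNorm (fun q : ↥(boxDom (N0 ℓ Mh k P)) × (Fin N × Fin N) => cubeML ℓ k Kc q.1.1)
              (fun q : ↥(boxDom (N0 ℓ Mh k P)) × (Fin N × Fin N) => cubeML ℓ k Kc q.1.1)
              (covDopU (fun ν => tshift (N0 ℓ Mh k P) (unitVec ν)) ((((ℓ : ℝ) + 1) ^ k)⁻¹)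
                  (fun ν u x => conjOp (U ν u x) (Ui ν u x)) (fun ν u x => conjOp (Ui ν u x) (U ν u x)) (levW D) u j * T ω σ u) Y Y' ≤
            covBU (ι := Fin (d + 1)) δ₁ ((ℓ : ℝ) + 1) (((ℓ : ℝ) + 1) * (α₀ * (2 + α₀))) j *
              (A' ω * Real.exp (-((δ₁ - 2 * μ) * D' ω Y Y')))) ∧
        ∀ ω, DomBy (toB6 (torusGeom Kc 0 0 0) 0 True) (D' ω) := by
  obtain ⟨δ₁, C, M₀, N₀, hδ₁, hC, hM₀, hN₀, hmain⟩ :=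
    blockWalkExpansion_covariantGreenCov_multiLevelTorus (dd := dd) (N' := N') (E := E) d ℓ hℓ aminus aplus a2minus a2plus ha ha2
  refine ⟨δ₁, C, M₀, N₀, hδ₁, hC, hM₀, hN₀, ?_⟩
  intro k Mh R hMh hM hR hRM P hP hP4 D a c haw hcw hac Kc _ hKc N c₀ Xs Rb U Ui Γ α₀ α₁ ε μ cμ hUh hUih hinv hα₀ hα₁ hUr hUc hUir hUic
    hDr hDc hlen hblkΓ hμ hμε hμκ hcμ hrow hq
  -- abbreviations: the level weight t(y) = L^{-lev y} ∈ [0, 1]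
  have ht0 : ∀ y : ↥(boxDom (N0 ℓ Mh k P)), (0 : ℝ) ≤ ((((ℓ : ℝ) + 1) ^ D.lev y.1))⁻¹ := fun y => by positivity
  have ht1 : ∀ y : ↥(boxDom (N0 ℓ Mh k P)), ((((ℓ : ℝ) + 1) ^ D.lev y.1))⁻¹ ≤ 1 := fun y =>
    inv_le_one_of_one_le₀ (one_le_pow₀ (by linarith [(Nat.cast_nonneg ℓ : (0 : ℝ) ≤ ℓ)]))
  have hle : ∀ y : ↥(boxDom (N0 ℓ Mh k P)), α₀ * ((((ℓ : ℝ) + 1) ^ D.lev y.1))⁻¹ ≤ α₀ := fun y =>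
    mul_le_of_le_one_right hα₀ (ht1 y)
  have hinv' : ∀ ν u y, Ui ν u y * U ν u y = 1 := fun ν u y => mul_eq_one_comm.1 (hinv ν u y)
  -- 87: holomorphy, inverse identity, the three adjoint windows
  have hAh : ∀ ν y p q, DifferentiableOn ℂ (fun u => conjOp (U ν u y) (Ui ν u y) p q) (ball (0 : E) Rb) :=
    fun ν y p q => conjOp_holo (hUh ν y) (hUih ν y) p q
  have hAih : ∀ ν y p q, DifferentiableOn ℂ (fun u => conjOp (Ui ν u y) (U ν u y) p q) (ball (0 : E) Rb) :=
    fun ν y p q => conjOp_holo (hUih ν y) (hUh ν y) p q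
  have hAinv : ∀ ν u y, conjOp (U ν u y) (Ui ν u y) * conjOp (Ui ν u y) (U ν u y) = 1 :=
    fun ν u y => conjOp_mul_conjOp_eq_one _ _ (hinv ν u y)
  have hA0 : ∀ ν, ∀ u ∈ ball (0 : E) Rb, ∀ y p, ∑ q, ‖(conjOp (U ν u y) (Ui ν u y) - 1) p q‖ ≤
      (α₀ * (2 + α₀)) * ((((ℓ : ℝ) + 1) ^ D.lev y.1))⁻¹ :=
    fun ν u hu y p => rowMass_adjBond_le _ _ hα₀ (ht0 y) (ht1 y) (hUr ν u hu y) (hUic ν u hu y) p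
  have hAi0 : ∀ ν, ∀ u ∈ ball (0 : E) Rb, ∀ y p, ∑ q, ‖(conjOp (Ui ν u y) (U ν u y) - 1) p q‖ ≤
      (α₀ * (2 + α₀)) * ((((ℓ : ℝ) + 1) ^ D.lev y.1))⁻¹ :=
    fun ν u hu y p => rowMass_adjBond_le _ _ hα₀ (ht0 y) (ht1 y) (hUir ν u hu y) (hUc ν u hu y) p
  have hA1 : ∀ ν, ∀ u ∈ ball (0 : E) Rb, ∀ x p,
      ∑ q, ‖(conjOp (U ν u x) (Ui ν u x) - conjOp (U ν u ((tshift (N0 ℓ Mh k P) (unitVec ν)).symm x))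
        (Ui ν u ((tshift (N0 ℓ Mh k P) (unitVec ν)).symm x))) p q‖ ≤
        ((1 + α₀) * (1 + (1 + α₀) ^ 2) * α₁) * ((((ℓ : ℝ) + 1) ^ D.lev x.1))⁻¹ ^ 2 := by
    intro ν u hu x p
    set x' := (tshift (N0 ℓ Mh k P) (unitVec ν)).symm x with hx'
    have hβ' := colSumNorm_inv_sub_inv_le (U ν u x) (Ui ν u x) (U ν u x') (Ui ν u x') (hinv' ν u x) (hinv ν u x') hα₀
      (hDc ν u hu x) (fun b => (hUic ν u hu x b).trans (hle x)) (fun b => (hUic ν u hu x' b).trans (hle x'))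
    have h := rowMass_adjDeriv_le (U ν u x) (Ui ν u x) (U ν u x') (Ui ν u x') hα₀ (hDr ν u hu x) hβ'
      (fun a' => (hUr ν u hu x' a').trans (hle x')) (fun b => (hUic ν u hu x b).trans (hle x)) p
    refine h.trans (le_of_eq ?_)
    ring
  exact hmain k Mh R hMh hM hR hRM P hP hP4 D a c haw hcw hac Kc hKc (Fin N × Fin N) c₀ Xs Rb
    (fun ν u y => conjOp (U ν u y) (Ui ν u y)) (fun ν u y => conjOp (Ui ν u y) (U ν u y)) Γ (α₀ * (2 + α₀))
    ((1 + α₀) * (1 + (1 + α₀) ^ 2) * α₁) ε μ cμ hAh hAih hAinv (by positivity) (by positivity) hA0 hAi0 hA1 hlen hblkΓ hμ hμε hμκ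
    hcμ hrow hq

/-- **THE SAME FOR `U = e^{X}` WITH TWO-SIDED (3.37) WINDOWS AND HOLOMORPHY ON `X`** (print's presentation `U = e^{iηA′}` read in
the adjoint representation): entries of `X` holomorphic on the ball; row AND column sums `Σ|X_μ(y)| ≤ a₀L^{−lev y}`,
`Σ|X_μ(x) − X_μ(x − e_μ)| ≤ a₁L^{−2lev x}`; then the fundamental two-sided windows hold with `α₀ = a₀e^{a₀}`, `α₁ = a₁e^{a₀}` (61a) and
the previous theorem applies to `U = e^{X}`, `U⁻ = e^{−X}` (holomorphy by 86, `e^{X}e^{−X} = 1`).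
[cite: Balaban1985BackgroundPropagators, Cor. 3.5 p.407, p.390, (3.37) p.396, (3.50)–(3.54) pp.400–401; Balaban1984PropagatorsII, (2.13)–(2.14) p.225; Balaban1988RG2Cluster, (1.11) p.5, p.15] -/
theorem blockWalkExpansion_covariantGreenAdExpCov_multiLevelTorus (d ℓ : ℕ) (hℓ : 1 ≤ ℓ) (aminus aplus a2minus a2plus : ℝ)
    (ha : 0 < aminus) (ha2 : 0 < a2minus) :
    ∃ δ₁ C M₀ : ℝ, ∃ N₀ : ℕ, 0 < δ₁ ∧ 0 < C ∧ 0 < M₀ ∧ 0 < N₀ ∧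
      ∀ (k Mh R : ℕ), 3 ≤ Mh → M₀ ≤ ((ℓ : ℝ) + 1) * Mh → 2 * (ℓ + 1) ≤ R → N₀ + 1 ≤ R * ((ℓ + 1) * Mh) →
      ∀ (P : Fin (d + 1) → ℕ) (hP : ∀ μ, 1 ≤ P μ) (hP4 : ∀ μ, 4 ≤ P μ) (D : TDomains d ℓ Mh k P R) (a c : ℕ → ℝ),
        (∀ i, 1 ≤ i → aminus ≤ a i ∧ a i ≤ aplus) → (∀ i, 1 ≤ i → a2minus ≤ c i ∧ c i ≤ a2plus) →
        (∀ i, 1 ≤ i → a (i + 1) = aNext ℓ (a i) (c i)) →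
      ∀ (Kc : Fin (d + 1) → ℕ) [∀ i, NeZero (Kc i)], (∀ i, N0 ℓ Mh k P i = (ℓ + 1) ^ k * Kc i) →
      ∀ (N : ℕ) (c₀ : B13.Consts) (Xs : Finset (UT Kc)) (Rb : ℝ)
        (X : Fin (d + 1) → E → ↥(boxDom (N0 ℓ Mh k P)) → Matrix (Fin N) (Fin N) ℂ)
        (Γ : ↥(boxDom (N0 ℓ Mh k P)) → List (↥(boxDom (N0 ℓ Mh k P)) × Fin (d + 1))) (a₀ a₁ ε μ cμ : ℝ),
      (∀ ν y a' b, DifferentiableOn ℂ (fun u => X ν u y a' b) (ball (0 : E) Rb)) → 0 ≤ a₀ → 0 ≤ a₁ →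
      (∀ ν, ∀ u ∈ ball (0 : E) Rb, ∀ y a', rowSumNorm (X ν u y) a' ≤ a₀ * ((((ℓ : ℝ) + 1) ^ D.lev y.1))⁻¹) →
      (∀ ν, ∀ u ∈ ball (0 : E) Rb, ∀ y b, colSumNorm (X ν u y) b ≤ a₀ * ((((ℓ : ℝ) + 1) ^ D.lev y.1))⁻¹) →
      (∀ ν, ∀ u ∈ ball (0 : E) Rb, ∀ x a', rowSumNorm (X ν u x - X ν u ((tshift (N0 ℓ Mh k P) (unitVec ν)).symm x)) a' ≤
        a₁ * ((((ℓ : ℝ) + 1) ^ D.lev x.1))⁻¹ ^ 2) →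
      (∀ ν, ∀ u ∈ ball (0 : E) Rb, ∀ x b, colSumNorm (X ν u x - X ν u ((tshift (N0 ℓ Mh k P) (unitVec ν)).symm x)) b ≤
        a₁ * ((((ℓ : ℝ) + 1) ^ D.lev x.1))⁻¹ ^ 2) →
      (∀ x, (Γ x).length ≤ (d + 1) * (ℓ + 1) ^ D.lev x.1) →
      (∀ x, ∀ b ∈ Γ x, blk ((ℓ + 1) ^ D.lev x.1) b.1.1 = blk ((ℓ + 1) ^ D.lev x.1) x.1) →
      0 ≤ μ → 2 * μ ≤ ε → 2 * μ ≤ δ₁ - ε - μ → 0 ≤ cμ →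
      RowSum (toB6 (torusGeom Kc 0 0 0) 0 True) μ cμ →
      cμ * (cμ * 1 * (1 * ((0 + ∑ j : Unit ⊕ (Fin (d + 1) ⊕ Fin (d + 1)),
        covAlphaW (((ℓ : ℝ) + 1) * ((a₀ * Real.exp a₀) * (2 + (a₀ * Real.exp a₀)))) (((d : ℝ) + 1) * (((1 + (a₀ * Real.exp a₀)) * (1 + (1 + (a₀ * Real.exp a₀)) ^ 2) * (a₁ * Real.exp a₀)) + (((ℓ : ℝ) + 1) * ((a₀ * Real.exp a₀) * (2 + (a₀ * Real.exp a₀)))) ^ 2) +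
          aplus * (Real.exp (2 * ((d : ℝ) + 1) * ((a₀ * Real.exp a₀) * (2 + (a₀ * Real.exp a₀)))) - 1)) j * covBW δ₁ ((ℓ : ℝ) + 1) j) * C)) * cμ) * cμ < 1 →
      ∃ (W : Type) (T : W → (TPt dd N' → ℂ) → E → Matrix (↥(boxDom (N0 ℓ Mh k P)) × (Fin N × Fin N)) (↥(boxDom (N0 ℓ Mh k P)) × (Fin N × Fin N)) ℂ)
        (SX' : Set W) (A' : W → ℝ) (D' : W → UT Kc → UT Kc → ℝ),
        BlockWalkExpansion c₀ (fun q : ↥(boxDom (N0 ℓ Mh k P)) × (Fin N × Fin N) => cubeML ℓ k Kc q.1.1)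
          (fun q : ↥(boxDom (N0 ℓ Mh k P)) × (Fin N × Fin N) => cubeML ℓ k Kc q.1.1)
          (fun (_ : TPt dd N' → ℂ) u =>
            (covLap ↥(boxDom (N0 ℓ Mh k P)) (Fin N × Fin N) (fun ν => tshift (N0 ℓ Mh k P) (unitVec ν)) ((((ℓ : ℝ) + 1) ^ k)⁻¹)
                (fun ν u x => conjOp (exp (X ν u x)) (exp (-X ν u x)) - 1)
                (fun ν u x => conjOp (exp (-X ν u ((tshift (N0 ℓ Mh k P) (unitVec ν)).symm x)))
                  (exp (X ν u ((tshift (N0 ℓ Mh k P) (unitVec ν)).symm x))) - 1) u +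
              (((ℓ : ℂ) + 1) ^ (2 * k) : ℂ) • covAvgOp D a (contourT Γ fun u b => conjOp (exp (X b.2 u b.1)) (exp (-X b.2 u b.1)))
                (contourTi Γ fun u b => conjOp (exp (-X b.2 u b.1)) (exp (X b.2 u b.1))) u)⁻¹)
          Xs Rb (ε - 2 * μ) (δ₁ - ε - μ - 2 * μ)
          (cμ * C * (1 * (1 - cμ * (cμ * 1 * (1 * ((0 + ∑ j : Unit ⊕ (Fin (d + 1) ⊕ Fin (d + 1)),
            covAlphaW (((ℓ : ℝ) + 1) * ((a₀ * Real.exp a₀) * (2 + (a₀ * Real.exp a₀)))) (((d : ℝ) + 1) * (((1 + (a₀ * Real.exp a₀)) * (1 + (1 + (a₀ * Real.exp a₀)) ^ 2) * (a₁ * Real.exp a₀)) + (((ℓ : ℝ) + 1) * ((a₀ * Real.exp a₀) * (2 + (a₀ * Real.exp a₀)))) ^ 2) +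
              aplus * (Real.exp (2 * ((d : ℝ) + 1) * ((a₀ * Real.exp a₀) * (2 + (a₀ * Real.exp a₀)))) - 1)) j * covBW δ₁ ((ℓ : ℝ) + 1) j) * C)) * cμ) * cμ)⁻¹) * cμ)
          T SX' A' D' (δ₁ - 2 * μ) ∧
        (∀ (j : Unit ⊕ (Fin (d + 1) ⊕ Fin (d + 1))) ω (σ : TPt dd N' → ℂ), (∀ i, ‖σ i‖ ≤ Real.exp c₀.κ₁) →
          ∀ u ∈ ball (0 : E) Rb, ∀ Y Y',
          blockNorm (fun q : ↥(boxDom (N0 ℓ Mh k P)) × (Fin N × Fin N) => cubeML ℓ k Kc q.1.1)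
              (fun q : ↥(boxDom (N0 ℓ Mh k P)) × (Fin N × Fin N) => cubeML ℓ k Kc q.1.1)
              (covDopU (fun ν => tshift (N0 ℓ Mh k P) (unitVec ν)) ((((ℓ : ℝ) + 1) ^ k)⁻¹)
                  (fun ν u x => conjOp (exp (X ν u x)) (exp (-X ν u x))) (fun ν u x => conjOp (exp (-X ν u x)) (exp (X ν u x)))
                  (levW D) u j * T ω σ u) Y Y' ≤
            covBU (ι := Fin (d + 1)) δ₁ ((ℓ : ℝ) + 1) (((ℓ : ℝ) + 1) * ((a₀ * Real.exp a₀) * (2 + a₀ * Real.exp a₀))) j *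
              (A' ω * Real.exp (-((δ₁ - 2 * μ) * D' ω Y Y')))) ∧
        ∀ ω, DomBy (toB6 (torusGeom Kc 0 0 0) 0 True) (D' ω) := by
  obtain ⟨δ₁, C, M₀, N₀, hδ₁, hC, hM₀, hN₀, hmain⟩ :=
    blockWalkExpansion_covariantGreenAdCov_multiLevelTorus (dd := dd) (N' := N') (E := E) d ℓ hℓ aminus aplus a2minus a2plus ha ha2
  refine ⟨δ₁, C, M₀, N₀, hδ₁, hC, hM₀, hN₀, ?_⟩
  intro k Mh R hMh hM hR hRM P hP hP4 D a c haw hcw hac Kc _ hKc N c₀ Xs Rb X Γ a₀ a₁ ε μ cμ hXh ha₀ ha₁ hXr hXc hDr hDc hlen hblkΓ hμ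
    hμε hμκ hcμ hrow hq
  have ht0 : ∀ y : ↥(boxDom (N0 ℓ Mh k P)), (0 : ℝ) ≤ ((((ℓ : ℝ) + 1) ^ D.lev y.1))⁻¹ := fun y => by positivity
  have ht1 : ∀ y : ↥(boxDom (N0 ℓ Mh k P)), ((((ℓ : ℝ) + 1) ^ D.lev y.1))⁻¹ ≤ 1 := fun y =>
    inv_le_one_of_one_le₀ (one_le_pow₀ (by linarith [(Nat.cast_nonneg ℓ : (0 : ℝ) ≤ ℓ)]))
  have hinv : ∀ ν u y, exp (X ν u y) * exp (-X ν u y) = 1 := fun ν u y => by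
    rw [Matrix.exp_neg]; exact Matrix.mul_nonsing_inv _ ((Matrix.isUnit_iff_isUnit_det _).1 (Matrix.isUnit_exp _))
  -- the one-sided letters of e^{±Y} − 1 from two-sided windows of Y at weight t ≤ 1 (61a + `exp_sub_one_le_eps`)
  have hexr : ∀ (Y : Matrix (Fin N) (Fin N) ℂ) (t : ℝ), 0 ≤ t → t ≤ 1 → (∀ a', rowSumNorm Y a' ≤ a₀ * t) →
      ∀ a', rowSumNorm (exp Y - 1) a' ≤ (a₀ * Real.exp a₀) * t := fun Y t h0 h1 hY a' =>
    ((rowSumNorm_exp_sub_one_le Y (by positivity : 0 ≤ t * a₀) (fun b => by rw [mul_comm]; exact hY b) a').trans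
      (exp_sub_one_le_eps h0 h1 ha₀)).trans (le_of_eq (by ring))
  have hexc : ∀ (Y : Matrix (Fin N) (Fin N) ℂ) (t : ℝ), 0 ≤ t → t ≤ 1 → (∀ b, colSumNorm Y b ≤ a₀ * t) →
      ∀ b, colSumNorm (exp Y - 1) b ≤ (a₀ * Real.exp a₀) * t := fun Y t h0 h1 hY b =>
    ((colSumNorm_exp_sub_one_le Y (by positivity : 0 ≤ t * a₀) (fun b => by rw [mul_comm]; exact hY b) b).trans
      (exp_sub_one_le_eps h0 h1 ha₀)).trans (le_of_eq (by ring))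
  have hXnr : ∀ ν, ∀ u ∈ ball (0 : E) Rb, ∀ y a', rowSumNorm (-X ν u y) a' ≤ a₀ * ((((ℓ : ℝ) + 1) ^ D.lev y.1))⁻¹ :=
    fun ν u hu y a' => by rw [rowSumNorm_neg]; exact hXr ν u hu y a'
  have hXnc : ∀ ν, ∀ u ∈ ball (0 : E) Rb, ∀ y b, colSumNorm (-X ν u y) b ≤ a₀ * ((((ℓ : ℝ) + 1) ^ D.lev y.1))⁻¹ :=
    fun ν u hu y b => by rw [colSumNorm_neg]; exact hXc ν u hu y b
  -- unweighted bounds `≤ a₀` for the derivative letter (t ≤ 1)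
  have hle : ∀ y : ↥(boxDom (N0 ℓ Mh k P)), a₀ * ((((ℓ : ℝ) + 1) ^ D.lev y.1))⁻¹ ≤ a₀ := fun y =>
    mul_le_of_le_one_right ha₀ (ht1 y)
  refine hmain k Mh R hMh hM hR hRM P hP hP4 D a c haw hcw hac Kc hKc N c₀ Xs Rb (fun ν u y => exp (X ν u y))
    (fun ν u y => exp (-X ν u y)) Γ (a₀ * Real.exp a₀) (a₁ * Real.exp a₀) ε μ cμ (differentiableOn_exp_entry_family hXh)
    (differentiableOn_exp_neg_entry_family hXh) hinv (by positivity) (by positivity)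
    (fun ν u hu y a' => hexr _ _ (ht0 y) (ht1 y) (hXr ν u hu y) a') (fun ν u hu y b => hexc _ _ (ht0 y) (ht1 y) (hXc ν u hu y) b)
    (fun ν u hu y a' => hexr _ _ (ht0 y) (ht1 y) (hXnr ν u hu y) a') (fun ν u hu y b => hexc _ _ (ht0 y) (ht1 y) (hXnc ν u hu y) b)
    (fun ν u hu x a' => ?_) (fun ν u hu x b => ?_) hlen hblkΓ hμ hμε hμκ hcμ hrow hq
  · -- rows of e^{X(x)} − e^{X(x′)}: both exponents have row sums ≤ a₀, the difference ≤ a₁t²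
    have h := rowSumNorm_exp_sub_exp_le (X ν u x) (X ν u ((tshift (N0 ℓ Mh k P) (unitVec ν)).symm x)) ha₀
      (by positivity : 0 ≤ a₁ * ((((ℓ : ℝ) + 1) ^ D.lev x.1))⁻¹ ^ 2) (fun a' => (hXr ν u hu x a').trans (hle x))
      (fun a' => (hXr ν u hu _ a').trans (hle _)) (hDr ν u hu x) a'
    exact h.trans (le_of_eq (by ring))
  · have h := colSumNorm_exp_sub_exp_le (X ν u x) (X ν u ((tshift (N0 ℓ Mh k P) (unitVec ν)).symm x)) ha₀
      (by positivity : 0 ≤ a₁ * ((((ℓ : ℝ) + 1) ^ D.lev x.1))⁻¹ ^ 2) (fun b => (hXc ν u hu x b).trans (hle x))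
      (fun b => (hXc ν u hu _ b).trans (hle _)) (hDc ν u hu x) b
    exact h.trans (le_of_eq (by ring))

end Green

end Summit.QuantumFields.BalabanUV.Gaps.D4WalkBlockCovariantAdjointCovMultiLevel

end
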